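import Summits.QuantumFields.YangMills.Theorems.SmallCircleAnchorAnchorGapFrozenWellPosed
import Summits.QuantumFields.QCD.Theorems.NestedDissectionSeaRobustYangMillsRGStubGaugeAveragingAux

/-!
# A ratio bound for factorised weights on product probability spaces (defect / Peierls estimates)

Helper for crux stmt-QuantumFields-11141 (`AnchorGap`, route `SmallCircleAnchor`), line
independent; the abstract analytic core of "holonomy defects are dilute at strong pinning"
(`SmallCircleAnchorAnchorGapDefectsDilute`). On a finite product `ι → Ω` of a probability space,
let a weight factorise as `e^{A} · F₀ · F₂` with `|A| ≤ B`, `F₀ ≥ 0` depending only on the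
coordinates in `S` and `F₂ ≥ 0` only on those outside `S`, and let `0 ≤ F₁ ≤ F₀` also depend only
on `S`. Then `∫ e^{A} F₁ F₂ ≤ e^{2B} (∫ F₁ / ∫ F₀) ∫ e^{A} F₀ F₂` (`defect_ratio_bound`,
registered sub-goal): bound `e^{A}` by `e^{±B}` and use the independence of disjoint coordinate
blocks (`pi_integral_mul_of_dependsOn`).
-/

set_option autoImplicit false

noncomputable section

namespace Summit.QuantumFields.YangMills.Theorems.AnchorGap

open MeasureTheory
open Summit.QuantumFields.QCD.Cruxes.RobustYangMillsRG.Birth.GaugeAveraging (pi_integral_mul_of_dependsOn)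

namespace Defects

/-- **Ratio bound for factorised weights** (registered sub-goal of crux `AnchorGap`). On
`ι → Ω` with the product of a probability measure `μ`: if `A, F₀, F₁, F₂` are measurable,
`|A| ≤ B`, `0 ≤ F₁ ≤ F₀ ≤ M`, `0 ≤ F₂ ≤ M`, `F₀, F₁` depend only on the coordinates in `S`, `F₂` only
on those in `Sᶜ`, and `∫ F₀ > 0`, then
`∫ e^{A}F₁F₂ ≤ e^{2B} (∫F₁ / ∫F₀) ∫ e^{A}F₀F₂`. [folklore] -/
theorem defect_ratio_bound :
    ∀ (ι : Type) [Fintype ι] (Ω : Type) [MeasurableSpace Ω] (μ : Measure Ω) [IsProbabilityMeasure μ] (ω₀ : Ω) (S : Set ι) (A F₀ F₁ F₂ : (ι → Ω) → ℝ) (B M : ℝ), Measurable A → Measurable F₀ → Measurable F₁ → Measurable F₂ → (∀ U, |A U| ≤ B) → (∀ U, 0 ≤ F₁ U) → (∀ U, F₁ U ≤ F₀ U) → (∀ U, F₀ U ≤ M) → (∀ U, 0 ≤ F₂ U) → (∀ U, F₂ U ≤ M) → DependsOn F₀ S → DependsOn F₁ S → DependsOn F₂ Sᶜ → 0 < ∫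 U, F₀ U ∂(Measure.pi fun _ : ι => μ) → ∫ U, Real.exp (A U) * (F₁ U * F₂ U) ∂(Measure.pi fun _ : ι => μ) ≤ Real.exp (2 * B) * ((∫ U, F₁ U ∂(Measure.pi fun _ : ι => μ)) / (∫ U, F₀ U ∂(Measure.pi fun _ : ι => μ))) * ∫ U, Real.exp (A U) * (F₀ U * F₂ U) ∂(Measure.pi fun _ : ι => μ) := by
  intro ι _ Ω _ μ _ ω₀ S A F₀ F₁ F₂ B M hA hF₀ hF₁ hF₂ hAB hF₁nn hF₁le hF₀M hF₂nn hF₂M h₀ h₁ h₂ hpos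
  set ν : Measure (ι → Ω) := Measure.pi fun _ : ι => μ with hν
  have hF₀nn : ∀ U, 0 ≤ F₀ U := fun U => (hF₁nn U).trans (hF₁le U)
  have heA : ∀ U, Real.exp (A U) ≤ Real.exp B := fun U =>
    Real.exp_le_exp.2 ((le_abs_self _).trans (hAB U))
  have heA' : ∀ U, Real.exp (-B) ≤ Real.exp (A U) := fun U =>
    Real.exp_le_exp.2 (by have := neg_abs_le (A U); have := hAB U; linarith)
  have hM : 0 ≤ M := (hF₂nn (fun _ => ω₀)).trans (hF₂M _)
  -- integrability of `φ · (Fa · F₂)` for bounded factors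
  have hint : ∀ (φ Fa : (ι → Ω) → ℝ), Measurable φ → Measurable Fa → (∀ U, 0 ≤ φ U) →
      (∀ U, φ U ≤ Real.exp B) → (∀ U, 0 ≤ Fa U) → (∀ U, Fa U ≤ M) →
      Integrable (fun U => φ U * (Fa U * F₂ U)) ν := by
    intro φ Fa hφm hFam hφ0 hφB hFa0 hFaM
    refine integrable_of_abs_le ν (hφm.mul (hFam.mul hF₂)) (c := Real.exp B * (M * M)) fun U => ?_
    rw [abs_of_nonneg (mul_nonneg (hφ0 U) (mul_nonneg (hFa0 U) (hF₂nn U)))]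
    exact mul_le_mul (hφB U) (mul_le_mul (hFaM U) (hF₂M U) (hF₂nn U) ((hFa0 U).trans (hFaM U)))
      (mul_nonneg (hFa0 U) (hF₂nn U)) (Real.exp_pos _).le
  have hexpm : Measurable fun U => Real.exp (A U) := Real.measurable_exp.comp hA
  have hI₁ := hint _ F₁ hexpm hF₁ (fun U => (Real.exp_pos _).le) heA hF₁nn
    (fun U => (hF₁le U).trans (hF₀M U))
  have hI₁' := hint (fun _ => Real.exp B) F₁ measurable_const hF₁ (fun _ => (Real.exp_pos _).le)
    (fun _ => le_rfl) hF₁nn (fun U => (hF₁le U).trans (hF₀M U))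
  have hI₀ := hint _ F₀ hexpm hF₀ (fun U => (Real.exp_pos _).le) heA hF₀nn hF₀M
  have hI₀' := hint (fun _ => Real.exp (-B)) F₀ measurable_const hF₀ (fun _ => (Real.exp_pos _).le)
    (fun _ => Real.exp_le_exp.2 (by have := hAB (fun _ => ω₀); have := abs_nonneg (A fun _ => ω₀); linarith))
    hF₀nn hF₀M
  -- the two bounds
  have hNum : ∫ U, Real.exp (A U) * (F₁ U * F₂ U) ∂ν ≤
      Real.exp B * ((∫ U, F₁ U ∂ν) * ∫ U, F₂ U ∂ν) := by
    calc ∫ U, Real.exp (A U) * (F₁ U * F₂ U) ∂ν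
        ≤ ∫ U, Real.exp B * (F₁ U * F₂ U) ∂ν :=
          integral_mono hI₁ hI₁' fun U =>
            mul_le_mul_of_nonneg_right (heA U) (mul_nonneg (hF₁nn U) (hF₂nn U))
      _ = Real.exp B * ((∫ U, F₁ U ∂ν) * ∫ U, F₂ U ∂ν) := by
          rw [integral_const_mul, hν, pi_integral_mul_of_dependsOn μ ω₀ S hF₁ hF₂ h₁ h₂]
  have hDen : Real.exp (-B) * ((∫ U, F₀ U ∂ν) * ∫ U, F₂ U ∂ν) ≤
      ∫ U, Real.exp (A U) * (F₀ U * F₂ U) ∂ν := by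
    calc Real.exp (-B) * ((∫ U, F₀ U ∂ν) * ∫ U, F₂ U ∂ν)
        = ∫ U, Real.exp (-B) * (F₀ U * F₂ U) ∂ν := by
          rw [integral_const_mul, hν, pi_integral_mul_of_dependsOn μ ω₀ S hF₀ hF₂ h₀ h₂]
      _ ≤ ∫ U, Real.exp (A U) * (F₀ U * F₂ U) ∂ν :=
          integral_mono hI₀' hI₀ fun U =>
            mul_le_mul_of_nonneg_right (heA' U) (mul_nonneg (hF₀nn U) (hF₂nn U))
  -- conclusion
  set a₁ : ℝ := ∫ U, F₁ U ∂ν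
  set a₀ : ℝ := ∫ U, F₀ U ∂ν
  set I₂ : ℝ := ∫ U, F₂ U ∂ν
  have hI₂ : 0 ≤ I₂ := integral_nonneg fun U => hF₂nn U
  have ha₁ : 0 ≤ a₁ := integral_nonneg fun U => hF₁nn U
  have hkey : Real.exp B * (a₁ * I₂) = Real.exp (2 * B) * (a₁ / a₀) * (Real.exp (-B) * (a₀ * I₂)) := by
    have : Real.exp (2 * B) * Real.exp (-B) = Real.exp B := by
      rw [← Real.exp_add]; congr 1; ring
    calc Real.exp B * (a₁ * I₂) = (Real.exp (2 * B) * Real.exp (-B)) * ((a₁ / a₀) * a₀) * I₂ := by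
          rw [this, div_mul_cancel₀ _ hpos.ne']; ring
      _ = _ := by ring
  calc ∫ U, Real.exp (A U) * (F₁ U * F₂ U) ∂ν ≤ Real.exp B * (a₁ * I₂) := hNum
    _ = Real.exp (2 * B) * (a₁ / a₀) * (Real.exp (-B) * (a₀ * I₂)) := hkey
    _ ≤ Real.exp (2 * B) * (a₁ / a₀) * ∫ U, Real.exp (A U) * (F₀ U * F₂ U) ∂ν :=
        mul_le_mul_of_nonneg_left hDen
          (mul_nonneg (Real.exp_pos _).le (div_nonneg ha₁ hpos.le))

end Defects

end Summit.QuantumFields.YangMills.Theorems.AnchorGap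

end
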